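import Mathlib
import Summits.ResolutionOfSingularities.ResolutionOfSingularities.Theorems.WeightedInvariantLocalWeightedDropNCResSurfGraphCurveChart
import Summits.ResolutionOfSingularities.ResolutionOfSingularities.Theorems.WeightedInvariantLocalWeightedDropNCResSurfGraphCurveMove
import Summits.ResolutionOfSingularities.ResolutionOfSingularities.Theorems.WeightedInvariantLocalWeightedDropNCResSurfGraphPartial
import Summits.ResolutionOfSingularities.ResolutionOfSingularities.Theorems.WeightedInvariantLocalWeightedDropNCResSurfGraphLoopStep
import Summits.ResolutionOfSingularities.ResolutionOfSingularities.Theorems.WeightedInvariantLocalWeightedDropNCResSettingHeadDropSurfaceCentre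

/-!
# `WeightedInvariant.LocalWeightedDrop`: NC-resolution settings for the TOT₂ line — GRAPH SURFACES, part 13: THE CURVE MOVE ON DECORATED STATES
# (B-permissibility of `Γ_a = S ∩ E_a`; its near point is the surface direction; the successor is again a permissible graph surface)

Crux item stmt-ResolutionOfSingularities-8899 `LocalWeightedDrop` (route `ResolutionOfSingularities/WeightedInvariant`), ENGINE skeleton v32/v33, residuals
`stub_spaceNCRankDrop` / `stub_wildWideApexFourStartsWon` (res-L1-w43-strat-1's line `directrix-cut` v3.1, piece PL = `ApexPlaneExit`, SURFACE sub-case;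
design memo `L/res-L1-w43-stub-4/g5/S-E2-SURF.md` §6–§7).  [OURS · L1 W4.3 · chain w43 · seat res-L1-w43-stub-4 gen 5; def-free on parts 1–12, on
res-L1-w43-stub-1's S-SET and res-L1-w43-stub-3's (N3) `TOT2Near.initEval_add_smul_eq_of_near_curve`; the curve-move twin of parts 5 and 7; the count
game is the programme's own; nothing here is a statement of any manuscript; AI-produced, gate-checked, weaker than expert review.]

THE MOVE (memo §6): `Φ̂ = shear_{a,b}(ψ̂)` (`ψ̂ = 0` on `E`, `ψ` elsewhere), `w = 𝟙_{≠ b}`; precondition: the off-base letters of `E` have traces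
divisible by `u₁` (`Γ_a ⊂ E_l`) and `b ∉ O` ((P2), memo §7).
* `strIdx_of_apply_eq_X` — a letter fixed by `Φ` is straightened to itself;
* **`isBPermissible_partialShear`** — the move is B-permissible from an admissibly decorated `(b₀, δ)` with a permissible graph surface;
* **`curveTangent_answer_of_head_eq`** — at a same-head answer `(c′, i′)` (`c′_b = 0` by the chart convention): `c′ = c′_a • tangentL a b ψ^E`
  with `c′_a ≠ 0` — the near point is the direction of the surface ((N3) + part 3's `Dir = T_S` in the coordinates of the move, parts 12 and
  `apexPlane_subst_legal`);
* **`inOffPlaneIdeal_curveTransform`** — read at the slot `a`, the successor `δ.transform Φ̂ w c′ a` carries the permissible graph surface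
  `(b′, 0, curveStep a ψ E c′)` (part 11's (C3′) on the restricted chart image, then strip `s^c` and the unit; twin of part 7).
-/

set_option linter.dupNamespace false -- mandated namespace of this single-conjunct summit

noncomputable section

namespace Summit.ResolutionOfSingularities.ResolutionOfSingularities.Theorems

namespace TameFourTupleDrop

namespace GraphSurf

open MvPowerSeries Literature.AlgebraicGeometry.Resolution

variable {k : Type} [Field k] {m : ℕ}

/-- A letter fixed by the substitution family is straightened to itself. -/
theorem strIdx_of_apply_eq_X {Φ : Fin (m + 1) → MvPowerSeries (Fin (m + 1)) k} {l : Fin (m + 1)} (hl : Φ l = X l) : strIdx Φ l = l := by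
  have h : ∃ (l' : Fin (m + 1)) (u : MvPowerSeries (Fin (m + 1)) k), constantCoeff u ≠ 0 ∧ Φ l = u * X l' :=
    ⟨l, 1, by rw [map_one]; exact one_ne_zero, by rw [one_mul, hl]⟩
  obtain ⟨u, hu, he⟩ := strIdx_spec h
  symm
  refine eq_of_X_dvd_X (k := k) ?_
  have hunit : IsUnit u := by
    rw [MvPowerSeries.isUnit_iff_constantCoeff]
    exact Ne.isUnit hu
  obtain ⟨v, hv⟩ := hunit
  refine ⟨↑v⁻¹, ?_⟩
  rw [← hl, he, ← hv, mul_comm, ← mul_assoc, Units.inv_mul, one_mul]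

section Move

variable {b₀ : MvPowerSeries (Fin (m + 1)) k} {δ : Decoration k m} {a b : Fin (m + 1)} {ψ : Fin (m + 1) → MvPowerSeries (Fin 2) k}

/-- The partial shear fixes every boundary letter. -/
theorem partialShear_apply_of_mem {E : Finset (Fin (m + 1))} {l : Fin (m + 1)} (hl : l ∈ E) :
    shear a b (fun j => if j ∈ E then 0 else ψ j) l = X l :=
  shear_eq_X_of_eq_zero (Or.inr (by simp [hl]))

/-- The weights `𝟙_{≠ b}` vanish only at `b`. -/
theorem wb_eq_zero_iff {l : Fin (m + 1)} : (fun j : Fin (m + 1) => if j = b then (0 : ℕ) else 1) l = 0 ↔ l = b := by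
  simp

/-- **THE CURVE MOVE ALONG `Γ_a` IS B-PERMISSIBLE** (memo §6–§7): from an admissibly decorated `(b₀, δ)` with a permissible graph surface `(a, b, ψ)`,
if every off-base boundary letter has trace divisible by `u₁` and `b` is not an old letter, the move `(Φ̂, 𝟙_{≠ b})` is B-permissible. -/
theorem isBPermissible_partialShear (hadm : Admissible b₀ δ) (hab : a ≠ b)
    (hψ : ∀ j, ¬ (j = a ∨ j = b) → constantCoeff (ψ j) = 0)
    (hE : ∀ l ∈ δ.E, ¬ (l = a ∨ l = b) → (X 0 : MvPowerSeries (Fin 2) k) ∣ ψ l)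
    (hperm : InOffPlaneIdeal a b δ.c (subst (shear a b ψ) (δ.f * ∏ l ∈ δ.O, X l))) :
    IsBPermissible δ (shear a b (fun j => if j ∈ δ.E then 0 else ψ j)) (fun j => if j = b then 0 else 1) := by
  classical
  have hψ' : ∀ j, ¬ (j = a ∨ j = b) → constantCoeff ((fun j => if j ∈ δ.E then 0 else ψ j) j) = 0 := fun j hj => by
    simp only
    split_ifs
    · exact map_zero _
    · exact hψ j hj
  have hmv : IsCountMove (shear a b (fun j => if j ∈ δ.E then 0 else ψ j)) (fun j => if j = b then 0 else 1) :=
    isCountMove_shear hψ' (fun j => by split_ifs <;> simp) ⟨a, by simp [hab]⟩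
  refine isBPermissible_of_totalO_weightedOrder hadm hmv (fun l hl => ⟨l, 1, by rw [map_one]; exact one_ne_zero, ?_⟩)
    (le_weightedOrder_partialShear hab hψ δ.E hE hperm)
  rw [one_mul, partialShear_apply_of_mem hl]

/-- **THE NEAR POINT OF THE CURVE MOVE IS THE SURFACE DIRECTION** (OURS · L1 W4.3; S-E2-SURF, memo §6).  From an admissibly decorated `(b₀, δ)`
with a permissible graph surface `(a, b, ψ)` of apex dimension `≤ 2` and off-base boundary traces divisible by `u₁`: at an answer `(c′, i′)` of the
curve move `(Φ̂, 𝟙_{≠ b})` (chart convention `c′_b = 0`) at which the head did not drop, `c′ = c′_a • tangentL a b ψ^E` with `c′_a ≠ 0`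
(`ψ^E = ψ` on `E`, `0` off `E`: the graph datum of the surface in the move's coordinates, part 12). -/
theorem curveTangent_answer_of_head_eq [Infinite k] (hadm : Admissible b₀ δ) (hab : a ≠ b)
    (hψ : ∀ j, ¬ (j = a ∨ j = b) → constantCoeff (ψ j) = 0)
    (hE : ∀ l ∈ δ.E, ¬ (l = a ∨ l = b) → (X 0 : MvPowerSeries (Fin 2) k) ∣ ψ l)
    (hperm : InOffPlaneIdeal a b δ.c (subst (shear a b ψ) (δ.f * ∏ l ∈ δ.O, X l)))
    (htwo : ∀ u₁ u₂ u₃ : Fin (m + 1) → k,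
      (∀ v, CobordantChart.initEval (fun _ : Fin (m + 1) => 1) (v + u₁) δ.c (δ.f * ∏ l ∈ δ.O, X l) =
        CobordantChart.initEval (fun _ : Fin (m + 1) => 1) v δ.c (δ.f * ∏ l ∈ δ.O, X l)) →
      (∀ v, CobordantChart.initEval (fun _ : Fin (m + 1) => 1) (v + u₂) δ.c (δ.f * ∏ l ∈ δ.O, X l) =
        CobordantChart.initEval (fun _ : Fin (m + 1) => 1) v δ.c (δ.f * ∏ l ∈ δ.O, X l)) →
      (∀ v, CobordantChart.initEval (fun _ : Fin (m + 1) => 1) (v + u₃) δ.c (δ.f * ∏ l ∈ δ.O, X l) =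
        CobordantChart.initEval (fun _ : Fin (m + 1) => 1) v δ.c (δ.f * ∏ l ∈ δ.O, X l)) →
      ∃ α β γ : k, (α ≠ 0 ∨ β ≠ 0 ∨ γ ≠ 0) ∧ α • u₁ + β • u₂ + γ • u₃ = 0)
    {c' : Fin (m + 1) → k} {i' : Fin (m + 1)} (hcb : c' b = 0) (hci' : c' i' ≠ 0) {A : ℕ} {G : MvPowerSeries (Fin (m + 1 + 1)) k}
    (hfac : subst (CobordantChart.chart (fun j : Fin (m + 1) => if j = b then 0 else 1) c')
      (subst (shear a b (fun j => if j ∈ δ.E then 0 else ψ j)) (δ.f * ∏ l ∈ δ.O, X l)) = X 0 ^ A * G) (hG : ¬ X 0 ∣ G)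
    (hhead : (δ.transform (shear a b (fun j => if j ∈ δ.E then 0 else ψ j)) (fun j => if j = b then 0 else 1) c' i').head = δ.head) :
    c' = c' a • tangentL a b (fun j => if j ∈ δ.E then ψ j else 0) ∧ c' a ≠ 0 := by
  classical
  have hf : δ.f ≠ 0 := hadm.2.1.ne_zero
  have hpermB := isBPermissible_partialShear hadm hab hψ hE hperm
  have hconv : ∀ l, (fun j : Fin (m + 1) => if j = b then (0 : ℕ) else 1) l = 0 → c' l = 0 := fun l hl => by
    rw [wb_eq_zero_iff.mp hl]; exact hcb
  have hw : ∀ l, (fun j : Fin (m + 1) => if j = b then (0 : ℕ) else 1) l ≤ 1 := fun l => by dsimp only; split_ifs <;> simp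
  obtain ⟨hA, -⟩ := Decoration.order_slice_totalO_eq hpermB hconv hf hci' hfac hG
  subst hA
  have hnear := GraphCurve.le_order_slice_of_head_eq hadm hpermB hconv hci' hfac hG hhead
  have hψ' : ∀ j, ¬ (j = a ∨ j = b) → constantCoeff ((fun j => if j ∈ δ.E then 0 else ψ j) j) = 0 := fun j hj => by
    simp only
    split_ifs
    · exact map_zero _
    · exact hψ j hj
  have hψE : ∀ j, ¬ (j = a ∨ j = b) → constantCoeff ((fun j => if j ∈ δ.E then ψ j else 0) j) = 0 := fun j hj => by
    simp only
    split_ifs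
    · exact hψ j hj
    · exact map_zero _
  have hordg : (subst (shear a b (fun j => if j ∈ δ.E then 0 else ψ j)) (δ.f * ∏ l ∈ δ.O, X l)).order = (δ.c : ℕ∞) :=
    Decoration.order_subst_totalO hadm hpermB.1
  have hP1 := le_weightedOrder_partialShear hab hψ δ.E hE hperm
  -- (N3): the answer is an invariance vector of the degree-`c` form of `Φ̂^* g`
  have hinv : ∀ v, CobordantChart.initEval (fun _ : Fin (m + 1) => 1) (v + c') δ.c
      (subst (shear a b (fun j => if j ∈ δ.E then 0 else ψ j)) (δ.f * ∏ l ∈ δ.O, X l)) =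
      CobordantChart.initEval (fun _ : Fin (m + 1) => 1) v δ.c
        (subst (shear a b (fun j => if j ∈ δ.E then 0 else ψ j)) (δ.f * ∏ l ∈ δ.O, X l)) := fun v => by
    have h := TOT2Near.initEval_add_smul_eq_of_near_curve _ c' hw hconv i' hci' _ hP1 hfac hnear 1 v
    rwa [one_smul] at h
  -- apex dimension ≤ 2 in the move's coordinates, and the surface datum there
  have htwo' := apexPlane_subst_legal (shear a b (fun j => if j ∈ δ.E then 0 else ψ j)) (constantCoeff_shear hψ')
    (isUnit_det_linMat_shear hψ') (δ.f * ∏ l ∈ δ.O, X l) (Decoration.order_totalO hadm) htwo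
  have hperm' := inOffPlaneIdeal_partialShear hψ δ.E hperm
  have hc' := eq_combo_tangent_of_inv hab hψE hordg hperm' htwo' hinv
  rw [hcb, zero_smul, add_zero] at hc'
  refine ⟨hc', fun h0 => hci' ?_⟩
  rw [hc', h0, zero_smul]
  rfl

/-- The coordinates of the near point: `c′_l = c′_a ∂₁ψ_l(0)` on the off-base letters of `E`, `c′_j = 0` off `E`. -/
theorem curve_answer_apply {E : Finset (Fin (m + 1))} {c' : Fin (m + 1) → k}
    (hc' : c' = c' a • tangentL a b (fun j => if j ∈ E then ψ j else 0)) :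
    (∀ l ∈ E, ¬ (l = a ∨ l = b) → c' l = c' a * coeff (Finsupp.single 0 1) (ψ l)) ∧
      (∀ j, j ∉ E → ¬ (j = a ∨ j = b) → c' j = 0) := by
  refine ⟨fun l hl hlab => ?_, fun j hj hjab => ?_⟩
  · conv_lhs => rw [hc']
    rw [Pi.smul_apply, tangentL_of_ne _ hlab, smul_eq_mul]
    simp [hl]
  · conv_lhs => rw [hc']
    rw [Pi.smul_apply, tangentL_of_ne _ hjab, smul_eq_mul]
    simp [hj]


/-- **THE SUCCESSOR OF THE CURVE MOVE IS A PERMISSIBLE GRAPH SURFACE** (OURS · L1 W4.3; S-E2-SURF, the curve-move step assembled on decorated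
states; twin of part 7).  At a same-head answer `c′ = c′_a • tangentL a b ψ^E` (`c′_a ≠ 0`, `c′_b = 0`) of the curve move `(Φ̂, 𝟙_{≠ b})`, read at
the slot `a`, the successor's product `g′ = f′·∏_{O′} x_l` is permissible along `(b′, 0, curveStep a ψ E c′)`, `b′ = predAbove a (succ b)`. -/
theorem inOffPlaneIdeal_curveTransform (hadm : Admissible b₀ δ) (hab : a ≠ b)
    (hψ : ∀ j, ¬ (j = a ∨ j = b) → constantCoeff (ψ j) = 0)
    (hE : ∀ l ∈ δ.E, ¬ (l = a ∨ l = b) → (X 0 : MvPowerSeries (Fin 2) k) ∣ ψ l)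
    (hperm : InOffPlaneIdeal a b δ.c (subst (shear a b ψ) (δ.f * ∏ l ∈ δ.O, X l)))
    {c' : Fin (m + 1) → k} (hc' : c' = c' a • tangentL a b (fun j => if j ∈ δ.E then ψ j else 0)) (hca : c' a ≠ 0) (hcb : c' b = 0)
    (hhead : (δ.transform (shear a b (fun j => if j ∈ δ.E then 0 else ψ j)) (fun j => if j = b then 0 else 1) c' a).head = δ.head) :
    InOffPlaneIdeal (Fin.predAbove a b.succ) 0
      (δ.transform (shear a b (fun j => if j ∈ δ.E then 0 else ψ j)) (fun j => if j = b then 0 else 1) c' a).c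
      (subst (shear (Fin.predAbove a b.succ) 0 (curveStep a ψ δ.E c'))
        ((δ.transform (shear a b (fun j => if j ∈ δ.E then 0 else ψ j)) (fun j => if j = b then 0 else 1) c' a).f *
          ∏ l ∈ (δ.transform (shear a b (fun j => if j ∈ δ.E then 0 else ψ j)) (fun j => if j = b then 0 else 1) c' a).O, X l)) := by
  classical
  set Φ := shear a b (fun j => if j ∈ δ.E then 0 else ψ j) with hΦ
  set w : Fin (m + 1) → ℕ := fun j => if j = b then 0 else 1 with hw
  set δ' := δ.transform Φ w c' a with hδ'
  have hf : δ.f ≠ 0 := hadm.2.1.ne_zero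
  have hpermB : IsBPermissible δ Φ w := isBPermissible_partialShear hadm hab hψ hE hperm
  have hconv : ∀ l, w l = 0 → c' l = 0 := fun l hl => by
    rw [hw] at hl
    rw [wb_eq_zero_iff.mp hl]; exact hcb
  obtain ⟨hcE, hcj⟩ := curve_answer_apply hc'
  -- the product through the chart: `(Φ̂^* g)(chart) = s^c · H`, `H|_{y_a = 0} = U · g′`
  obtain ⟨H, U, hfacH, hH, hU, hsl⟩ := Decoration.totalO_chart_eq hpermB hconv hf hca
  have ho : δ'.o = δ.o := GraphCurve.o_transform_eq_of_head_eq hhead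
  have hc : δ'.c = δ.c := GraphCurve.c_transform_eq_of_head_eq hhead
  have hfstrict : δ'.f = δ.strict Φ w c' a := Decoration.transform_f_eq_strict_of_o_transform_eq hpermB hconv hf hca ho
  have hO : δ'.O = Decoration.newLetters δ.O Φ c' a := GraphCurve.O_transform_eq_of_head_eq hhead
  have hg' : TupleGame.slice a H = U * (δ'.f * ∏ l ∈ δ'.O, X l) := by
    rw [hsl, hfstrict, hO, Decoration.prod_X_newLetters hpermB c' hca δ.O_subset]
  -- the weighted restricted chart image of `Φ̂^* g` is `s^c · H|_{y_a = 0}`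
  have hrestr := SliceChart.subst_restrictedChart w c' hconv (subst Φ (δ.f * ∏ l ∈ δ.O, X l)) δ.c H hfacH a
  rw [hw, wchart_eq_cchart hab c' hcb] at hrestr
  have hslice_eq : subst (fun j : Fin (m + 1 + 1) => if j = a.succ then (0 : MvPowerSeries (Fin (m + 1)) k) else X (Fin.predAbove a j)) H =
      TupleGame.slice a H := rfl
  rw [hslice_eq, hg'] at hrestr
  -- part 11's (C3′) on the restricted chart image
  have hstep := inOffPlaneIdeal_curveChart_step hab hψ hE hcE hcj hperm
  rw [← hΦ, hrestr] at hstep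
  -- strip `s^c` (a base letter of the successor surface) and the unit
  have hss : HasSubst (shear (Fin.predAbove a b.succ) 0 (curveStep a ψ δ.E c')) := hasSubst_shear_curveStep (b := b) hcE
  have hsh0 := constantCoeff_curveStep_of_ne (b := b) hcE
  rw [← coe_substAlgHom hss, map_mul, map_mul, map_pow, coe_substAlgHom, subst_X hss, shear_of_base (Or.inr rfl)] at hstep
  have hU' : constantCoeff (subst (shear (Fin.predAbove a b.succ) 0 (curveStep a ψ δ.E c')) U) ≠ 0 := by
    rw [TOT2E1.constantCoeff_subst_of_constantCoeff_zero _ (constantCoeff_shear hsh0)]; exact hU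
  have h1 := InOffPlaneIdeal.of_X_pow_mul_base (a := Fin.predAbove a b.succ) (b := (0 : Fin (m + 1))) (Or.inr rfl) hstep
  have h2 := h1.mul_left (subst (shear (Fin.predAbove a b.succ) 0 (curveStep a ψ δ.E c')) U)⁻¹
  rw [← mul_assoc, MvPowerSeries.inv_mul_cancel _ hU', one_mul] at h2
  rw [hc]
  exact h2

end Move

end GraphSurf

end TameFourTupleDrop

end Summit.ResolutionOfSingularities.ResolutionOfSingularities.Theorems

end
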